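import Mathlib
import Summits.Ventures.HodgeRepro2.T5AmiceTransform
import Summits.Ventures.HodgeRepro2.T5AmiceDirac

/-!
# T5AmiceConvolution — convolution of measures on `ℤ_p`, and `f_{m₁ * m₂} = f_{m₁} · f_{m₂}`

Cell pub-hodge-repro2, Tier 5 support (seat p7; route/T5-CHECK-G-p7.md §3 S5). S5 reads the measure
`m` as an element of the IWASAWA ALGEBRA `W[[Γ_𝔭]] ≅ W[[T]]` (`γ₀ ↦ 1 + T`); T5AmiceTransform /
T5AmiceInverse (p400619 / p400741) landed that isomorphism at the level of modules, and the record
(CHECK-G §20.2) states explicitly: «the ring structure, i.e. convolution, is not modelled». This file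
models it. For continuous functionals `m₁, m₂` on `C(ℤ_p, R)`:

* `shift x f := (y ↦ f (y + x))` and `partialInt m₂ f := (x ↦ m₂ (shift x f))` — the partial integral
  `x ↦ ∫ f(x + y) dm₂(y)`, continuous in `x` (`continuous_shift`: `x ↦ shift x f` is continuous into
  `C(ℤ_p, R)`, Mathlib's `ContinuousMap.continuous_of_continuous_uncurry`);
* `conv m₁ m₂ := (f ↦ m₁ (partialInt m₂ f))` — the CONVOLUTION `∫∫ f(x + y) dm₁(x) dm₂(y)`, a linear
  functional bounded by `C₁ C₂` (`conv_bound`);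
* `amice_conv`: `f_{m₁ * m₂} = f_{m₁} · f_{m₂}` — THE AMICE TRANSFORM IS MULTIPLICATIVE (the
  Chu–Vandermonde identity `(x + y choose n) = Σ_{i+j=n} (x choose i)(y choose j)` of Mathlib's
  `Ring.add_choose_eq` on the binomial ring `ℤ_p`);
* `conv_dirac`: `δ_a * δ_b = δ_{a+b}`; `conv_dirac_zero` / `dirac_zero_conv`: `δ_0` is the unit; with
  T5AmiceDirac's `amice_dirac_zero : f_{δ_0} = 1` the transform is a ring homomorphism
  «`W[[Γ_𝔭]] → W[[T]]`»; `conv_comm` / `conv_assoc` (complete ultrametric `R`): the convolution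
  algebra is commutative and associative, read off from `R[[T]]` through injectivity of the transform.

Mathlib + own T5AmiceTransform, T5AmiceDirac only.
-/

namespace Summit.Ventures.HodgeRepro2.T5AmiceConvolution

open PadicInt Filter Topology
open Summit.Ventures.HodgeRepro2.T5AmiceTransform
open Summit.Ventures.HodgeRepro2.T5AmiceDirac

variable {p : ℕ} [hp : Fact p.Prime]

/-! ### Translation and the partial integral -/

section Shift

variable {R : Type*} [NormedCommRing R]

/-- The translate `shift x f = (y ↦ f (y + x))`. -/
noncomputable def shift (x : ℤ_[p]) (f : C(ℤ_[p], R)) : C(ℤ_[p], R) :=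
  f.comp ⟨fun y => y + x, continuous_id.add continuous_const⟩

/-- `shift x f y = f (y + x)`. -/
@[simp] theorem shift_apply (x : ℤ_[p]) (f : C(ℤ_[p], R)) (y : ℤ_[p]) : shift x f y = f (y + x) := rfl

/-- `shift 0 f = f`. -/
@[simp] theorem shift_zero (f : C(ℤ_[p], R)) : shift 0 f = f := by
  ext y
  simp

/-- `shift` is additive in `f`. -/
theorem shift_add (x : ℤ_[p]) (f g : C(ℤ_[p], R)) : shift x (f + g) = shift x f + shift x g := by
  ext y
  simp

/-- `shift` commutes with scalars. -/
theorem shift_smul (x : ℤ_[p]) (c : R) (f : C(ℤ_[p], R)) : shift x (c • f) = c • shift x f := by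
  ext y
  simp

/-- `‖shift x f‖ ≤ ‖f‖`. -/
theorem norm_shift_le (x : ℤ_[p]) (f : C(ℤ_[p], R)) : ‖shift x f‖ ≤ ‖f‖ :=
  (ContinuousMap.norm_le _ (norm_nonneg f)).mpr fun y => f.norm_coe_le_norm (y + x)

/-- `x ↦ shift x f` is continuous `ℤ_p → C(ℤ_p, R)` (uniform continuity of `f` on the compact `ℤ_p`,
packaged by Mathlib's `ContinuousMap.continuous_of_continuous_uncurry`). -/
theorem continuous_shift (f : C(ℤ_[p], R)) : Continuous fun x => shift x f :=
  ContinuousMap.continuous_of_continuous_uncurry _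
    (f.continuous.comp (continuous_snd.add continuous_fst))

/-- The partial integral `partialInt m f = (x ↦ ∫ f(y + x) dm(y)) = (x ↦ m (shift x f))`. -/
noncomputable def partialInt (m : C(ℤ_[p], R) →ₗ[R] R) (hm : Continuous m) (f : C(ℤ_[p], R)) :
    C(ℤ_[p], R) :=
  ⟨fun x => m (shift x f), hm.comp (continuous_shift f)⟩

/-- `partialInt m f x = m (shift x f)`. -/
@[simp] theorem partialInt_apply (m : C(ℤ_[p], R) →ₗ[R] R) (hm : Continuous m) (f : C(ℤ_[p], R))
    (x : ℤ_[p]) : partialInt m hm f x = m (shift x f) := rfl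

/-- `partialInt m` is additive. -/
theorem partialInt_add (m : C(ℤ_[p], R) →ₗ[R] R) (hm : Continuous m) (f g : C(ℤ_[p], R)) :
    partialInt m hm (f + g) = partialInt m hm f + partialInt m hm g := by
  ext x
  simp [shift_add]

/-- `partialInt m` is `R`-linear. -/
theorem partialInt_smul (m : C(ℤ_[p], R) →ₗ[R] R) (hm : Continuous m) (c : R) (f : C(ℤ_[p], R)) :
    partialInt m hm (c • f) = c • partialInt m hm f := by
  ext x
  simp [shift_smul]

/-- `‖partialInt m f‖ ≤ C ‖f‖` for `‖m φ‖ ≤ C ‖φ‖`. -/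
theorem norm_partialInt_le (m : C(ℤ_[p], R) →ₗ[R] R) (hm : Continuous m) {C : ℝ} (hC : 0 ≤ C)
    (hb : ∀ φ, ‖m φ‖ ≤ C * ‖φ‖) (f : C(ℤ_[p], R)) : ‖partialInt m hm f‖ ≤ C * ‖f‖ := by
  refine (ContinuousMap.norm_le _ (mul_nonneg hC (norm_nonneg f))).mpr fun x => ?_
  rw [partialInt_apply]
  calc ‖m (shift x f)‖ ≤ C * ‖shift x f‖ := hb _
    _ ≤ C * ‖f‖ := by gcongr; exact norm_shift_le x f

/-! ### Convolution -/

/-- THE CONVOLUTION `(m₁ * m₂)(f) = ∫∫ f(x + y) dm₁(x) dm₂(y) = m₁ (partialInt m₂ f)`. -/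
noncomputable def conv (m₁ m₂ : C(ℤ_[p], R) →ₗ[R] R) (hm₂ : Continuous m₂) :
    C(ℤ_[p], R) →ₗ[R] R where
  toFun f := m₁ (partialInt m₂ hm₂ f)
  map_add' f g := by rw [partialInt_add, map_add]
  map_smul' c f := by rw [partialInt_smul, map_smul, RingHom.id_apply]

/-- `conv m₁ m₂ f = m₁ (partialInt m₂ f)`. -/
@[simp] theorem conv_apply (m₁ m₂ : C(ℤ_[p], R) →ₗ[R] R) (hm₂ : Continuous m₂) (f : C(ℤ_[p], R)) :
    conv m₁ m₂ hm₂ f = m₁ (partialInt m₂ hm₂ f) := rfl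

/-- `‖(m₁ * m₂) f‖ ≤ C₁ C₂ ‖f‖`. -/
theorem conv_bound (m₁ m₂ : C(ℤ_[p], R) →ₗ[R] R) (hm₂ : Continuous m₂) {C₁ C₂ : ℝ} (hC₁ : 0 ≤ C₁)
    (hC₂ : 0 ≤ C₂) (hb₁ : ∀ φ, ‖m₁ φ‖ ≤ C₁ * ‖φ‖) (hb₂ : ∀ φ, ‖m₂ φ‖ ≤ C₂ * ‖φ‖)
    (f : C(ℤ_[p], R)) : ‖conv m₁ m₂ hm₂ f‖ ≤ (C₁ * C₂) * ‖f‖ := by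
  rw [conv_apply]
  calc ‖m₁ (partialInt m₂ hm₂ f)‖ ≤ C₁ * ‖partialInt m₂ hm₂ f‖ := hb₁ _
    _ ≤ C₁ * (C₂ * ‖f‖) := by gcongr; exact norm_partialInt_le m₂ hm₂ hC₂ hb₂ f
    _ = (C₁ * C₂) * ‖f‖ := (mul_assoc _ _ _).symm

/-- The convolution of bounded measures is continuous. -/
theorem continuous_conv (m₁ m₂ : C(ℤ_[p], R) →ₗ[R] R) (hm₂ : Continuous m₂) {C₁ C₂ : ℝ}
    (hC₁ : 0 ≤ C₁) (hC₂ : 0 ≤ C₂) (hb₁ : ∀ φ, ‖m₁ φ‖ ≤ C₁ * ‖φ‖) (hb₂ : ∀ φ, ‖m₂ φ‖ ≤ C₂ * ‖φ‖) :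
    Continuous (conv m₁ m₂ hm₂) :=
  continuous_of_bound _ (C₁ * C₂) (conv_bound m₁ m₂ hm₂ hC₁ hC₂ hb₁ hb₂)

end Shift

variable {R : Type*} [NormedCommRing R] [Algebra ℤ_[p] R] [IsBoundedSMul ℤ_[p] R]

/-! ### The Chu–Vandermonde identity on the Mahler basis -/

/-- `ℤ_p`-scalars act on `C(ℤ_p, R)` through the algebra map. -/
theorem smul_eq_algebraMap_smul (c : ℤ_[p]) (f : C(ℤ_[p], R)) :
    c • f = (algebraMap ℤ_[p] R c) • f := by
  ext y
  simp [Algebra.smul_def]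

/-- A functional is `ℤ_p`-linear: `m (c • f) = c • m f`. -/
theorem map_padic_smul (m : C(ℤ_[p], R) →ₗ[R] R) (c : ℤ_[p]) (f : C(ℤ_[p], R)) :
    m (c • f) = c • m f := by
  rw [smul_eq_algebraMap_smul, map_smul, smul_eq_mul, Algebra.smul_def]

/-- The translate of a Mahler basis function: `(y + x choose n) = Σ_{i+j=n} (x choose j) (y choose i)` —
`shift x (x choose n) = Σ_{ij ∈ antidiagonal n} (x choose ij.2) • mahlerTerm 1 ij.1`. -/
theorem shift_mahlerTerm (x : ℤ_[p]) (n : ℕ) :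
    shift x (mahlerTerm (1 : R) n) =
      ∑ ij ∈ Finset.HasAntidiagonal.antidiagonal n, (Ring.choose x ij.2) • mahlerTerm (1 : R) ij.1 := by
  ext y
  simp only [shift_apply, mahlerTerm_apply, mahler_apply, ContinuousMap.coe_sum, Finset.sum_apply,
    ContinuousMap.smul_apply]
  rw [Ring.add_choose_eq n (Commute.all y x)]
  simp only [Finset.sum_smul, smul_smul, mul_comm]

/-- `partialInt m₂ (x choose n) = Σ_{ij ∈ antidiagonal n} mahlerTerm (m₂ (x choose ij.1)) ij.2`. -/
theorem partialInt_mahlerTerm (m₂ : C(ℤ_[p], R) →ₗ[R] R) (hm₂ : Continuous m₂) (n : ℕ) :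
    partialInt m₂ hm₂ (mahlerTerm (1 : R) n) =
      ∑ ij ∈ Finset.HasAntidiagonal.antidiagonal n, mahlerTerm (m₂ (mahlerTerm (1 : R) ij.1)) ij.2 := by
  ext x
  rw [partialInt_apply, shift_mahlerTerm, map_sum]
  simp only [map_padic_smul, ContinuousMap.coe_sum, Finset.sum_apply, mahlerTerm_apply, mahler_apply]

/-- THE AMICE TRANSFORM IS MULTIPLICATIVE: `f_{m₁ * m₂} = f_{m₁} · f_{m₂}`. -/
theorem amice_conv (m₁ m₂ : C(ℤ_[p], R) →ₗ[R] R) (hm₂ : Continuous m₂) :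
    amice (conv m₁ m₂ hm₂) = amice m₁ * amice m₂ := by
  ext n
  rw [PowerSeries.coeff_mul, coeff_amice, conv_apply, partialInt_mahlerTerm, map_sum,
    ← Finset.Nat.sum_antidiagonal_swap]
  refine Finset.sum_congr rfl fun ij _ => ?_
  rw [map_mahlerTerm, coeff_amice, coeff_amice, mul_comm]
  rfl

/-! ### Dirac measures: `δ_a * δ_b = δ_{a+b}`, `δ_0` is the unit -/

omit [Algebra ℤ_[p] R] [IsBoundedSMul ℤ_[p] R] in
/-- `δ_a * δ_b = δ_{a+b}`. -/
theorem conv_dirac (a b : ℤ_[p]) :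
    conv (dirac (R := R) a) (dirac b) (continuous_dirac b) = dirac (a + b) := by
  ext f
  simp [add_comm]

omit [Algebra ℤ_[p] R] [IsBoundedSMul ℤ_[p] R] in
/-- `δ_0 * m = m`. -/
theorem dirac_zero_conv (m : C(ℤ_[p], R) →ₗ[R] R) (hm : Continuous m) :
    conv (dirac (R := R) 0) m hm = m := by
  ext f
  simp

omit [Algebra ℤ_[p] R] [IsBoundedSMul ℤ_[p] R] in
/-- `m * δ_0 = m`. -/
theorem conv_dirac_zero (m : C(ℤ_[p], R) →ₗ[R] R) :
    conv m (dirac (R := R) 0) (continuous_dirac 0) = m := by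
  ext f
  simp only [conv_apply]
  congr 1
  ext x
  simp

/-! ### Commutativity and associativity, read off from `R[[T]]` -/

section Complete

variable [IsUltrametricDist R] [CompleteSpace R]

/-- `m₁ * m₂ = m₂ * m₁` for continuous, bounded `m₁, m₂` (the transform is injective and `R[[T]]` is
commutative). -/
theorem conv_comm (m₁ m₂ : C(ℤ_[p], R) →ₗ[R] R) (hm₁ : Continuous m₁) (hm₂ : Continuous m₂)
    {C₁ C₂ : ℝ} (hC₁ : 0 ≤ C₁) (hC₂ : 0 ≤ C₂) (hb₁ : ∀ φ, ‖m₁ φ‖ ≤ C₁ * ‖φ‖)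
    (hb₂ : ∀ φ, ‖m₂ φ‖ ≤ C₂ * ‖φ‖) :
    conv m₁ m₂ hm₂ = conv m₂ m₁ hm₁ := by
  apply eq_of_amice_eq (continuous_conv m₁ m₂ hm₂ hC₁ hC₂ hb₁ hb₂)
    (continuous_conv m₂ m₁ hm₁ hC₂ hC₁ hb₂ hb₁)
  rw [amice_conv, amice_conv, mul_comm]

/-- `(m₁ * m₂) * m₃ = m₁ * (m₂ * m₃)` for continuous, bounded measures. -/
theorem conv_assoc (m₁ m₂ m₃ : C(ℤ_[p], R) →ₗ[R] R) (hm₂ : Continuous m₂) (hm₃ : Continuous m₃)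
    {C₁ C₂ C₃ : ℝ} (hC₁ : 0 ≤ C₁) (hC₂ : 0 ≤ C₂) (hC₃ : 0 ≤ C₃)
    (hb₁ : ∀ φ, ‖m₁ φ‖ ≤ C₁ * ‖φ‖) (hb₂ : ∀ φ, ‖m₂ φ‖ ≤ C₂ * ‖φ‖) (hb₃ : ∀ φ, ‖m₃ φ‖ ≤ C₃ * ‖φ‖) :
    conv (conv m₁ m₂ hm₂) m₃ hm₃ = conv m₁ (conv m₂ m₃ hm₃) (continuous_conv m₂ m₃ hm₃ hC₂ hC₃ hb₂ hb₃) := by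
  apply eq_of_amice_eq
  · exact continuous_conv _ _ hm₃ (mul_nonneg hC₁ hC₂) hC₃ (conv_bound m₁ m₂ hm₂ hC₁ hC₂ hb₁ hb₂) hb₃
  · exact continuous_conv _ _ _ hC₁ (mul_nonneg hC₂ hC₃) hb₁ (conv_bound m₂ m₃ hm₃ hC₂ hC₃ hb₂ hb₃)
  · rw [amice_conv, amice_conv, amice_conv, amice_conv, mul_assoc]

end Complete

end Summit.Ventures.HodgeRepro2.T5AmiceConvolution
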